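import Literature.NumberTheory.Sieve.LinearEquationsInPrimesProofs
import Mathlib.Analysis.Complex.Exponential
import HarnessLib

/-!
# Linear equations in primes: the singular series, uniformly in the system (Green–Tao 2010, Lemma 1.3)

Trunk T-SIEVE (`Literature/NumberTheory/Sieve`). `LinearEquationsInPrimesProofs.lean` proves
Green–Tao's Lemma 1.3 *for a fixed system* (`|β_p - 1| ≤ t²/p²` for all sufficiently large
`p` depending on `Ψ`). The `W`-trick of §5 ("From Lemma 1.3 followed by the multiplicativity of
the local factors we have `∏_p β_p = ∏_{p ≤ w} β_p + o(1)`", proof of the Main Theorem assuming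
Thm. 5.1) needs the printed *uniform* form: the `O()`-constants depend only on `t, d, L`. This
file proves it, for systems of finite complexity ("no two of the forms `ψ̇₁, …, ψ̇_t` are
parallel") whose coefficients are bounded by `L` (which is what `‖Ψ‖_N ≤ L` gives,
`natAbs_coeff_le_of_affLinSize_le`):

* `Literature.NumberTheory.Sieve.exists_minor_ne_zero` — two non-parallel integer vectors have a non-zero `2 × 2` minor
  ("elementary linear algebra");
* `Literature.NumberTheory.Sieve.abs_localFactor_sub_one_le_of_coeff_bound` — **Lemma 1.3, uniform**: if
  `|ψ̇ᵢ(e_j)| ≤ L`, then `|β_p - 1| ≤ t²/p²` for every prime `p > 2L²` with `p ≥ 2t`;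
* `Literature.NumberTheory.Sieve.localFactor_nonneg`, `Literature.NumberTheory.Sieve.localFactor_prime_le` — `0 ≤ β_p ≤ (p/(p-1))^t ≤ 2^t`;
* `Literature.NumberTheory.Sieve.sum_Ioc_inv_sq_le` — `∑_{w < n ≤ x} n⁻² ≤ w⁻¹` (from Mathlib's `sum_Ioc_inv_sq_le_sub`);
  the product estimate `|∏ β_p - 1| ≤ exp(∑ |β_p - 1|) - 1` is Mathlib's
  `Finset.norm_prod_one_add_sub_one_le`;
* `Literature.NumberTheory.Sieve.singularProductPartial_le_uniform` — `∏_{p ≤ w} β_p ≤ B(t, L)` for all `w`;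
* `Literature.NumberTheory.Sieve.singularProduct_sub_partial_uniform` — **"`∏_p β_p = ∏_{p ≤ w} β_p + o(1)`" uniformly**:
  for every `ε > 0` there is `w₀ = w₀(t, L, ε)` with `|∏_p β_p - ∏_{p ≤ w} β_p| ≤ ε` for all
  `w ≥ w₀` and all such systems.

## References

* B. Green, T. Tao, *Linear equations in primes*, Ann. of Math. (2) 171 (2010), 1753–1850
  (arXiv:math/0606088): Lemma 1.3 ("`β_p = 1 + O_{t,d,L}(p⁻²)`" if no two forms are affinely
  related) and the sentence following it; §5, proof of the Main Theorem assuming Thm. 5.1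
  ("`∏_p β_p = ∏_{p ≤ w} β_p + o(1) = β_W + o(1)`").
-/

noncomputable section

open Filter Finset
open scoped Topology

namespace Literature.NumberTheory.Sieve

variable {d t : ℕ}

/-! ### Elementary linear algebra: non-parallel vectors have a non-zero minor -/

/-- If `u ≠ 0` and `u, v` are not parallel (`a u = b v ⇒ a = b = 0`), some `2 × 2` minor
`u_k v_l - u_l v_k` is non-zero. [folklore] -/
theorem exists_minor_ne_zero {u v : Fin d → ℤ} (hu : u ≠ 0)
    (h : ∀ a b : ℤ, a • u = b • v → a = 0 ∧ b = 0) : ∃ k l, u k * v l - u l * v k ≠ 0 := by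
  obtain ⟨k, hk⟩ : ∃ k, u k ≠ 0 := by
    by_contra hh
    push Not at hh
    exact hu (funext hh)
  by_contra hh
  push Not at hh
  have hpar : (v k) • u = (u k) • v := by
    funext l
    simp only [Pi.smul_apply, smul_eq_mul]
    have := hh k l
    linarith
  exact hk (h _ _ hpar).2

/-- The size bound `‖Ψ‖_N ≤ L` bounds every coefficient: `|ψ̇ᵢ(e_j)| ≤ L`.
[cite: GreenTao2010, (1.1)] -/
theorem natAbs_coeff_le_of_affLinSize_le {Ψ : Fin t → AffLinForm d} {N : ℝ} {L : ℕ}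
    (h : affLinSize Ψ N ≤ L) (i : Fin t) (j : Fin d) : ((Ψ i).coeff j).natAbs ≤ L := by
  have h1 : |((Ψ i).coeff j : ℝ)| ≤ ∑ j', |((Ψ i).coeff j' : ℝ)| :=
    Finset.single_le_sum (f := fun j' => |((Ψ i).coeff j' : ℝ)|) (fun _ _ => abs_nonneg _)
      (Finset.mem_univ j)
  have h2 : ∑ j', |((Ψ i).coeff j' : ℝ)| ≤ ∑ i', ∑ j', |((Ψ i').coeff j' : ℝ)| :=
    Finset.single_le_sum (f := fun i' => ∑ j', |((Ψ i').coeff j' : ℝ)|)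
      (fun _ _ => Finset.sum_nonneg fun _ _ => abs_nonneg _) (Finset.mem_univ i)
  have h3 : ∑ i', ∑ j', |((Ψ i').coeff j' : ℝ)| ≤ affLinSize Ψ N :=
    le_add_of_nonneg_right (Finset.sum_nonneg fun _ _ => abs_nonneg _)
  have h4 : (((Ψ i).coeff j).natAbs : ℝ) ≤ L := by
    rw [Nat.cast_natAbs, Int.cast_abs]
    exact h1.trans (h2.trans (h3.trans h))
  exact_mod_cast h4

/-! ### Lemma 1.3, uniformly in the system -/

/-- **Green–Tao 2010, Lemma 1.3, uniform in `Ψ`** (as printed: "If furthermore no two of the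
forms `ψ₁, …, ψ_t` are affinely related i.e. no two of the forms `ψ̇₁, …, ψ̇_t` are parallel …
then we have `β_p = 1 + O_{t,d,L}(p⁻²)`"; here with the explicit constant of the fixed-system
proof): if every coefficient satisfies `|ψ̇ᵢ(e_j)| ≤ L`, then `|β_p - 1| ≤ t²/p²` for every prime
`p > 2L²` with `p ≥ 2t`. Proof as printed: each `ψ̇ᵢ ≢ 0 (mod p)` (a non-zero coefficient is
`≤ L < p` in absolute value), and for `i ≠ j` some `2 × 2` minor of `(ψ̇ᵢ, ψ̇ⱼ)` is non-zero and
`≤ 2L² < p` in absolute value, so "`ψᵢ` and `ψⱼ` cannot be linear multiples of each other modulo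
`p`"; then Bonferroni. [cite: GreenTao2010, Lemma 1.3] -/
theorem abs_localFactor_sub_one_le_of_coeff_bound (Ψ : Fin t → AffLinForm d)
    (hΨ : IsNondegenerateSystem Ψ) (hfc : IsFiniteComplexitySystem Ψ) {L : ℕ}
    (hL : ∀ i j, ((Ψ i).coeff j).natAbs ≤ L) {p : ℕ} (hp : p.Prime) (hpL : 2 * L ^ 2 < p)
    (hpt : 2 * t ≤ p) : |localFactor Ψ p - 1| ≤ (t : ℝ) ^ 2 / (p : ℝ) ^ 2 := by
  haveI := Fact.mk hp
  have hcoeff : ∀ i, ∃ k, (Ψ i).coeff k ≠ 0 := fun i => by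
    by_contra hh
    push Not at hh
    exact hΨ.1 i (funext hh)
  have hLp : L < p := by
    rcases Nat.eq_zero_or_pos L with hL0 | hL0
    · rw [hL0]; exact hp.pos
    · nlinarith
  have h1 : ∀ i, #{v : Fin d → ZMod p | (Ψ i).modEval p v = 0} * p = p ^ d := by
    intro i
    obtain ⟨k, hk⟩ := hcoeff i
    exact card_modZero_mul (Ψ i) fun hz =>
      intCast_zmod_ne_zero_of_natAbs_lt hk ((hL i k).trans_lt hLp) (congr_fun hz k)
  have h2 : ∀ ij ∈ (univ : Finset (Fin t)).offDiag,
      #{v : Fin d → ZMod p | (Ψ ij.1).modEval p v = 0 ∧ (Ψ ij.2).modEval p v = 0} * p ^ 2 ≤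
        p ^ d := by
    intro ij hij
    have hne : ij.1 ≠ ij.2 := (Finset.mem_offDiag.mp hij).2.2
    obtain ⟨k, l, hD⟩ := exists_minor_ne_zero (hΨ.1 ij.1) (hfc ij.1 ij.2 hne)
    refine (card_modZero_pair_mul (Ψ ij.1) (Ψ ij.2) k l
      (intCast_zmod_ne_zero_of_natAbs_lt hD ?_)).le
    calc ((Ψ ij.1).coeff k * (Ψ ij.2).coeff l - (Ψ ij.1).coeff l * (Ψ ij.2).coeff k).natAbs
        ≤ ((Ψ ij.1).coeff k * (Ψ ij.2).coeff l).natAbs +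
            ((Ψ ij.1).coeff l * (Ψ ij.2).coeff k).natAbs := Int.natAbs_sub_le _ _
      _ = ((Ψ ij.1).coeff k).natAbs * ((Ψ ij.2).coeff l).natAbs +
            ((Ψ ij.1).coeff l).natAbs * ((Ψ ij.2).coeff k).natAbs := by
          rw [Int.natAbs_mul, Int.natAbs_mul]
      _ ≤ L * L + L * L :=
          add_le_add (Nat.mul_le_mul (hL _ _) (hL _ _)) (Nat.mul_le_mul (hL _ _) (hL _ _))
      _ = 2 * L ^ 2 := by ring
      _ < p := hpL
  have hAp : (∑ i, #{v : Fin d → ZMod p | (Ψ i).modEval p v = 0}) * p = t * p ^ d := by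
    rw [Finset.sum_mul, Finset.sum_congr rfl fun i _ => h1 i, Finset.sum_const, Finset.card_univ,
      Fintype.card_fin, smul_eq_mul]
  have hBp : (∑ ij ∈ (univ : Finset (Fin t)).offDiag,
      #{v : Fin d → ZMod p | (Ψ ij.1).modEval p v = 0 ∧ (Ψ ij.2).modEval p v = 0}) * p ^ 2 ≤
        (t * t - t) * p ^ d := by
    rw [Finset.sum_mul]
    calc _ ≤ ∑ ij ∈ (univ : Finset (Fin t)).offDiag, p ^ d :=
          Finset.sum_le_sum fun ij hij => h2 ij hij
      _ = _ := by
          rw [Finset.sum_const, smul_eq_mul, Finset.offDiag_card, Finset.card_univ,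
            Fintype.card_fin]
  have hG : goodCount Ψ p + _ = Fintype.card (Fin d → ZMod p) :=
    card_filter_forall_not_add (fun i v => (Ψ i).modEval p v = 0)
  rw [card_zmod_pow p d] at hG
  have hb1 := bonferroni_one (fun i v => (Ψ i).modEval p v = 0)
  have hb2 := bonferroni_two (fun i v => (Ψ i).modEval p v = 0)
  rw [localFactor_prime]
  exact localFactor_estimate hp.two_le hpt hAp hBp (by omega) (by omega)

/-! ### Crude bounds on the local factors -/

/-- `Λ_{ℤ/qℤ} ≥ 0`. [cite: GreenTao2010, (1.5)] -/
theorem localVonMangoldt_nonneg (q : ℕ) (b : ℤ) : 0 ≤ localVonMangoldt q b := by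
  unfold localVonMangoldt
  split_ifs <;> positivity

/-- `β_q ≥ 0`. [cite: GreenTao2010, (1.6)] -/
theorem localFactor_nonneg (Ψ : Fin t → AffLinForm d) (q : ℕ) : 0 ≤ localFactor Ψ q := by
  unfold localFactor
  exact mul_nonneg (by positivity)
    (Finset.sum_nonneg fun n _ => Finset.prod_nonneg fun i _ => localVonMangoldt_nonneg _ _)

/-- `β_p ≤ (p/(p-1))^t` for a prime `p` (the integrand of (1.6) is at most `(p/(p-1))^t`).
[cite: GreenTao2010, proof of Lemma 1.3] -/
theorem localFactor_prime_le (Ψ : Fin t → AffLinForm d) {p : ℕ} (hp : p.Prime) :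
    localFactor Ψ p ≤ ((p : ℝ) / (p - 1)) ^ t := by
  haveI := Fact.mk hp
  have hp0 : (0 : ℝ) < p := by exact_mod_cast hp.pos
  have hp1 : (0 : ℝ) ≤ (p : ℝ) / (p - 1) := by
    have : (1 : ℝ) < p := by exact_mod_cast hp.one_lt
    exact div_nonneg hp0.le (by linarith)
  have hgc : (goodCount Ψ p : ℝ) ≤ (p : ℝ) ^ d := by
    have : goodCount Ψ p ≤ Fintype.card (Fin d → ZMod p) := Finset.card_le_univ _
    rw [card_zmod_pow] at this
    exact_mod_cast this
  rw [localFactor_prime]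
  calc ((p : ℝ) ^ d)⁻¹ * (((p : ℝ) / (p - 1)) ^ t * goodCount Ψ p)
      ≤ ((p : ℝ) ^ d)⁻¹ * (((p : ℝ) / (p - 1)) ^ t * (p : ℝ) ^ d) := by
        gcongr
    _ = ((p : ℝ) / (p - 1)) ^ t := by
        field_simp

/-- `(p/(p-1))^t ≤ 2^t` for `p ≥ 2`. [folklore] -/
theorem div_pred_pow_le_two_pow {p : ℕ} (hp : 2 ≤ p) (t : ℕ) :
    ((p : ℝ) / (p - 1)) ^ t ≤ 2 ^ t := by
  have hp2 : (2 : ℝ) ≤ p := by exact_mod_cast hp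
  have h1 : (0 : ℝ) < (p : ℝ) - 1 := by linarith
  have h : (p : ℝ) / (p - 1) ≤ 2 := by
    rw [div_le_iff₀ h1]
    linarith
  exact pow_le_pow_left₀ (div_nonneg (by linarith) h1.le) h t

/-! ### A tail bound -/

/-- `∑_{w < n ≤ x} n⁻² ≤ w⁻¹` for `1 ≤ w` (from Mathlib's `sum_Ioc_inv_sq_le_sub`, dropping the
`-x⁻¹`, and trivially for `x < w`). [folklore] -/
theorem sum_Ioc_inv_sq_le {w : ℕ} (hw : 1 ≤ w) (x : ℕ) :
    ∑ n ∈ Finset.Ioc w x, ((n : ℝ) ^ 2)⁻¹ ≤ (w : ℝ)⁻¹ := by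
  rcases le_or_gt w x with hwx | hxw
  · have hx : (0 : ℝ) ≤ (x : ℝ)⁻¹ := by positivity
    linarith [_root_.sum_Ioc_inv_sq_le_sub (α := ℝ) (by omega) hwx]
  · rw [Finset.Ioc_eq_empty (by omega), Finset.sum_empty]
    positivity

/-! ### The singular series, uniformly in the system -/

/-- The threshold of the uniform Lemma 1.3: primes `p ≥ p₀(t, L)` satisfy `p > 2L²`, `p ≥ 2t`
and `p ≥ 2`. [cite: GreenTao2010, Lemma 1.3] -/
def localFactorThreshold (t L : ℕ) : ℕ :=
  max (2 * L ^ 2 + 1) (max (2 * t) 2)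

/-- Beyond the threshold, `|β_p - 1| ≤ t²/p²` uniformly. [cite: GreenTao2010, Lemma 1.3] -/
theorem abs_localFactor_sub_one_le_of_threshold_le (Ψ : Fin t → AffLinForm d)
    (hΨ : IsNondegenerateSystem Ψ) (hfc : IsFiniteComplexitySystem Ψ) {L : ℕ}
    (hL : ∀ i j, ((Ψ i).coeff j).natAbs ≤ L) {p : ℕ} (hp : p.Prime)
    (hp₀ : localFactorThreshold t L ≤ p) : |localFactor Ψ p - 1| ≤ (t : ℝ) ^ 2 / (p : ℝ) ^ 2 :=
  abs_localFactor_sub_one_le_of_coeff_bound Ψ hΨ hfc hL hp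
    (by unfold localFactorThreshold at hp₀; omega) (by unfold localFactorThreshold at hp₀; omega)

/-- **`∏_{p ≤ w} β_p = O_{t,L}(1)` uniformly**: there is `B = B(t, L)` with
`0 ≤ ∏_{p ≤ w} β_p ≤ B` for every `w` and every system of `t` forms of finite complexity with
coefficients bounded by `L` (Remark after Lemma 1.6: "if the system has finite complexity, then
`β_p = 1 + O_{t,d,L}(1/p²)` and so the singular series `∏_p β_p` is either zero, or is bounded
above and below by constants depending only on `t, d, L`"; only the upper bound, for the partial
products, is asserted here). [cite: GreenTao2010, Remark after Lemma 1.6] -/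
theorem singularProductPartial_le_uniform (t L : ℕ) : ∃ B : ℝ, 0 ≤ B ∧
    ∀ (d : ℕ) (Ψ : Fin t → AffLinForm d), IsNondegenerateSystem Ψ →
      IsFiniteComplexitySystem Ψ → (∀ i j, ((Ψ i).coeff j).natAbs ≤ L) →
        ∀ w : ℕ, 0 ≤ singularProductPartial Ψ w ∧
          singularProductPartial Ψ w ≤ B := by
  set p₀ := localFactorThreshold t L with hp₀
  have hp₀2 : 2 ≤ p₀ := by simp [hp₀, localFactorThreshold]
  refine ⟨(2 ^ t) ^ p₀ * Real.exp ((t : ℝ) ^ 2), by positivity, ?_⟩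
  intro d Ψ hΨ hfc hL w
  have hnonneg : ∀ s : Finset ℕ, 0 ≤ ∏ p ∈ s, localFactor Ψ p := fun s =>
    Finset.prod_nonneg fun p _ => localFactor_nonneg Ψ p
  refine ⟨hnonneg _, ?_⟩
  unfold singularProductPartial
  rw [← Finset.prod_filter_mul_prod_filter_not (Nat.primesLE w) (fun p => p < p₀)]
  have hsmall : ∏ p ∈ (Nat.primesLE w).filter (fun p => p < p₀), localFactor Ψ p ≤
      (2 ^ t) ^ p₀ := by
    calc ∏ p ∈ (Nat.primesLE w).filter (fun p => p < p₀), localFactor Ψ p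
        ≤ ∏ p ∈ (Nat.primesLE w).filter (fun p => p < p₀), (2 : ℝ) ^ t := by
          refine Finset.prod_le_prod (fun p _ => localFactor_nonneg Ψ p) fun p hp => ?_
          have hpp : p.Prime := (Nat.mem_primesLE.mp (Finset.mem_filter.mp hp).1).2
          exact (localFactor_prime_le Ψ hpp).trans (div_pred_pow_le_two_pow hpp.two_le t)
      _ = ((2 : ℝ) ^ t) ^ #((Nat.primesLE w).filter (fun p => p < p₀)) := Finset.prod_const _
      _ ≤ ((2 : ℝ) ^ t) ^ p₀ := by
          refine pow_le_pow_right₀ (one_le_pow₀ (by norm_num)) ?_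
          calc #((Nat.primesLE w).filter (fun p => p < p₀)) ≤ #(Finset.range p₀) :=
                Finset.card_le_card fun p hp =>
                  Finset.mem_range.mpr (Finset.mem_filter.mp hp).2
            _ = p₀ := Finset.card_range _
  have hlarge : ∏ p ∈ (Nat.primesLE w).filter (fun p => ¬ p < p₀), localFactor Ψ p ≤
      Real.exp ((t : ℝ) ^ 2) := by
    calc ∏ p ∈ (Nat.primesLE w).filter (fun p => ¬ p < p₀), localFactor Ψ p
        ≤ ∏ p ∈ (Nat.primesLE w).filter (fun p => ¬ p < p₀), (1 + (t : ℝ) ^ 2 / (p : ℝ) ^ 2) := by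
          refine Finset.prod_le_prod (fun p _ => localFactor_nonneg Ψ p) fun p hp => ?_
          obtain ⟨hp1, hp2⟩ := Finset.mem_filter.mp hp
          have hpp : p.Prime := (Nat.mem_primesLE.mp hp1).2
          have := abs_localFactor_sub_one_le_of_threshold_le Ψ hΨ hfc hL hpp (by omega)
          linarith [(abs_le.mp this).2]
      _ ≤ Real.exp (∑ p ∈ (Nat.primesLE w).filter (fun p => ¬ p < p₀),
            (t : ℝ) ^ 2 / (p : ℝ) ^ 2) :=
          Real.prod_one_add_le_exp_sum _ (fun p => by positivity)
      _ ≤ Real.exp ((t : ℝ) ^ 2) := by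
          refine Real.exp_le_exp.mpr ?_
          calc ∑ p ∈ (Nat.primesLE w).filter (fun p => ¬ p < p₀), (t : ℝ) ^ 2 / (p : ℝ) ^ 2
              ≤ ∑ n ∈ Finset.Ioc (p₀ - 1) w, (t : ℝ) ^ 2 / (n : ℝ) ^ 2 := by
                refine Finset.sum_le_sum_of_subset_of_nonneg (fun p hp => ?_)
                  (fun n _ _ => by positivity)
                obtain ⟨hp1, hp2⟩ := Finset.mem_filter.mp hp
                have := (Nat.mem_primesLE.mp hp1).1
                exact Finset.mem_Ioc.mpr ⟨by omega, this⟩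
            _ = (t : ℝ) ^ 2 * ∑ n ∈ Finset.Ioc (p₀ - 1) w, ((n : ℝ) ^ 2)⁻¹ := by
                rw [Finset.mul_sum]
                exact Finset.sum_congr rfl fun n _ => by rw [div_eq_mul_inv]
            _ ≤ (t : ℝ) ^ 2 * ((p₀ - 1 : ℕ) : ℝ)⁻¹ := by
                gcongr
                exact sum_Ioc_inv_sq_le (by omega) w
            _ ≤ (t : ℝ) ^ 2 * 1 := by
                gcongr
                have h1 : (1 : ℝ) ≤ ((p₀ - 1 : ℕ) : ℝ) := by
                  exact_mod_cast (by omega : 1 ≤ p₀ - 1)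
                exact inv_le_one_of_one_le₀ h1
            _ = (t : ℝ) ^ 2 := mul_one _
  exact mul_le_mul hsmall hlarge (hnonneg _) (by positivity)

/-- **"`∏_p β_p = ∏_{p ≤ w} β_p + o(1)`", uniformly in the system** (Green–Tao 2010, §5, proof
of the Main Theorem assuming Thm. 5.1: "From Lemma 1.3 followed by the multiplicativity of the
local factors `β` we have `∏_p β_p = ∏_{p ≤ w} β_p + o(1)`"; the `o(1)` is as `w → ∞` and, by
the convention of §3, uniform in systems of `t` forms of finite complexity with `‖Ψ‖_N ≤ L`).
Rendered with the coefficient bound `|ψ̇ᵢ(e_j)| ≤ L`: for every `ε > 0` there is `w₀(t, L, ε)`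
with `|∏_p β_p - ∏_{p ≤ w} β_p| ≤ ε` for all `w ≥ w₀` and all such `Ψ` (any `d`).
[cite: GreenTao2010, Lemma 1.3 and §5 (Proof of the Main Theorem assuming Theorem 5.1)] -/
theorem singularProduct_sub_partial_uniform (t L : ℕ) : ∀ ε : ℝ, 0 < ε → ∃ w₀ : ℕ,
    ∀ (d : ℕ) (Ψ : Fin t → AffLinForm d), IsNondegenerateSystem Ψ →
      IsFiniteComplexitySystem Ψ → (∀ i j, ((Ψ i).coeff j).natAbs ≤ L) →
        ∀ w : ℕ, w₀ ≤ w → |singularProduct Ψ - singularProductPartial Ψ w| ≤ ε := by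
  intro ε hε
  obtain ⟨B, hB0, hB⟩ := singularProductPartial_le_uniform t L
  set p₀ := localFactorThreshold t L with hp₀
  -- `w₀`: beyond the threshold, `w > t²`, and `2 B t² / w ≤ ε`
  refine ⟨max p₀ (max (t ^ 2 + 1) (⌈2 * B * (t : ℝ) ^ 2 / ε⌉₊ + 1)), ?_⟩
  intro d Ψ hΨ hfc hL w hw
  have hwp₀ : p₀ ≤ w := le_trans (le_max_left _ _) hw
  have hwt : t ^ 2 + 1 ≤ w := le_trans ((le_max_left _ _).trans (le_max_right _ _)) hw
  have hwε : ⌈2 * B * (t : ℝ) ^ 2 / ε⌉₊ + 1 ≤ w :=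
    le_trans ((le_max_right _ _).trans (le_max_right _ _)) hw
  have hw0 : (0 : ℝ) < w := by exact_mod_cast (by omega : 0 < w)
  have hw1 : 1 ≤ w := by omega
  -- the tail estimate for every `x ≥ w`
  have htail : ∀ x : ℕ, w ≤ x →
      |singularProductPartial Ψ x - singularProductPartial Ψ w| ≤ ε := by
    intro x hwx
    set T := ∏ p ∈ Nat.primesLE x \ Nat.primesLE w, localFactor Ψ p with hT
    have hsplit : singularProductPartial Ψ x = singularProductPartial Ψ w * T := by
      unfold singularProductPartial
      rw [hT, mul_comm, Finset.prod_sdiff (Nat.primesLE_mono hwx)]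
    have hT1 : |T - 1| ≤ 2 * ((t : ℝ) ^ 2 / w) := by
      have hmem : ∀ p ∈ Nat.primesLE x \ Nat.primesLE w, p.Prime ∧ w < p ∧ p ≤ x := by
        intro p hp
        obtain ⟨hp1, hp2⟩ := Finset.mem_sdiff.mp hp
        rw [Nat.mem_primesLE] at hp1 hp2
        exact ⟨hp1.2, by by_contra hh; exact hp2 ⟨by omega, hp1.2⟩, hp1.1⟩
      have hsum : ∑ p ∈ Nat.primesLE x \ Nat.primesLE w, |localFactor Ψ p - 1| ≤
          (t : ℝ) ^ 2 / w := by
        calc ∑ p ∈ Nat.primesLE x \ Nat.primesLE w, |localFactor Ψ p - 1|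
            ≤ ∑ p ∈ Nat.primesLE x \ Nat.primesLE w, (t : ℝ) ^ 2 / (p : ℝ) ^ 2 := by
              refine Finset.sum_le_sum fun p hp => ?_
              obtain ⟨hpp, hwp, -⟩ := hmem p hp
              exact abs_localFactor_sub_one_le_of_threshold_le Ψ hΨ hfc hL hpp (by omega)
          _ ≤ ∑ n ∈ Finset.Ioc w x, (t : ℝ) ^ 2 / (n : ℝ) ^ 2 := by
              refine Finset.sum_le_sum_of_subset_of_nonneg (fun p hp => ?_)
                (fun n _ _ => by positivity)
              obtain ⟨-, hwp, hpx⟩ := hmem p hp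
              exact Finset.mem_Ioc.mpr ⟨hwp, hpx⟩
          _ = (t : ℝ) ^ 2 * ∑ n ∈ Finset.Ioc w x, ((n : ℝ) ^ 2)⁻¹ := by
              rw [Finset.mul_sum]
              exact Finset.sum_congr rfl fun n _ => by rw [div_eq_mul_inv]
          _ ≤ (t : ℝ) ^ 2 * (w : ℝ)⁻¹ := by
              gcongr
              exact sum_Ioc_inv_sq_le hw1 x
          _ = (t : ℝ) ^ 2 / w := by rw [div_eq_mul_inv]
      -- `|∏ β_p - 1| ≤ exp (∑ |β_p - 1|) - 1` (Mathlib's `Finset.norm_prod_one_add_sub_one_le`)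
      have h1 : |T - 1| ≤ Real.exp (∑ p ∈ Nat.primesLE x \ Nat.primesLE w,
          |localFactor Ψ p - 1|) - 1 := by
        have := Finset.norm_prod_one_add_sub_one_le (Nat.primesLE x \ Nat.primesLE w)
          (fun p => localFactor Ψ p - 1)
        simp only [add_sub_cancel, Real.norm_eq_abs] at this
        rw [hT]
        exact this
      have h2 : Real.exp (∑ p ∈ Nat.primesLE x \ Nat.primesLE w, |localFactor Ψ p - 1|) - 1 ≤
          Real.exp ((t : ℝ) ^ 2 / w) - 1 := by
        linarith [Real.exp_le_exp.mpr hsum]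
      have h3 : Real.exp ((t : ℝ) ^ 2 / w) - 1 ≤ 2 * ((t : ℝ) ^ 2 / w) := by
        have hu0 : 0 ≤ (t : ℝ) ^ 2 / w := by positivity
        have hu1 : (t : ℝ) ^ 2 / w ≤ 1 := by
          rw [div_le_one hw0]
          exact_mod_cast (by omega : t ^ 2 ≤ w)
        have := Real.abs_exp_sub_one_le (x := (t : ℝ) ^ 2 / w) (by rwa [abs_of_nonneg hu0])
        rw [abs_of_nonneg hu0] at this
        exact (le_abs_self _).trans this
      linarith
    obtain ⟨hSw0, hSwB⟩ := hB d Ψ hΨ hfc hL w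
    calc |singularProductPartial Ψ x - singularProductPartial Ψ w|
        = |singularProductPartial Ψ w| * |T - 1| := by
          rw [hsplit, ← abs_mul]
          ring_nf
      _ ≤ B * (2 * ((t : ℝ) ^ 2 / w)) :=
          mul_le_mul (by rwa [abs_of_nonneg hSw0]) hT1 (abs_nonneg _) hB0
      _ = (2 * B * (t : ℝ) ^ 2) / w := by ring
      _ ≤ ε := by
          rw [div_le_iff₀ hw0]
          have h1 : 2 * B * (t : ℝ) ^ 2 / ε ≤ ⌈2 * B * (t : ℝ) ^ 2 / ε⌉₊ := Nat.le_ceil _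
          have h2 : (⌈2 * B * (t : ℝ) ^ 2 / ε⌉₊ : ℝ) + 1 ≤ w := by exact_mod_cast hwε
          rw [div_le_iff₀ hε] at h1
          nlinarith
  -- pass to the limit `x → ∞`
  have hlim : Tendsto (fun x => |singularProductPartial Ψ x - singularProductPartial Ψ w|)
      atTop (𝓝 |singularProduct Ψ - singularProductPartial Ψ w|) :=
    (continuous_abs.tendsto _).comp
      ((tendsto_singularProductPartial_holds d t Ψ hΨ).sub tendsto_const_nhds)
  exact le_of_tendsto hlim (Filter.eventually_atTop.mpr ⟨w, htail⟩)

end Literature.NumberTheory.Sieve
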